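import Summits.BirchSwinnertonDyer.Rank1Residual.O6.X4CongruenceFirstLayerAnchor
import Literature.NumberTheory.EllipticCurves.RootNumber
import HarnessLib

/-!
# O6 / X4 ∧ ¬(12.5.2), rank 0, the `t = 1` sub-corner: the SELMER RIGIDITY CERTIFICATE T-X4E-rig (+ (P-par), (G2-nec)) — typed targets
(cell `b2b-bsdres`, lane CLASS-CLOSURE, class O6 §3.4 ∩ X4, sub-corner R-X4E-t1 = {`388800ha1`, `388800ij1`}; planner o6-r1 GEN 22
 ADDENDA 2 / 3 / 4 (+ 6 / 7 in the sibling `O6/X4SelmerRigidityInstances.lean`) — memo `HOME/b2b-bsdres-o6-r1/gen22/O6-GEN22.md`, typed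
 sketch FROZEN as `gen23/lean/O6X3KatoMember.lean` (sha256 `1ebe8b840718b67c…`, 1 102 l., `SHA256SUMS.gen23`; `lean check` rc 0 by the
 planner) §X4E-t1-loc / §X4E-t1-par / §X4E-rig; docket cc-lead ⟦gen60⟧/⟦gen61⟧ (2′)(iv) (c25), conditions (A)–(G); typer of record
 cc-typer-5 GEN 16; THIRD sibling of `O6/X4CongruenceAnchor.lean` ((T-μ), (A⋆), T-X4E) and `O6/X4CongruenceFirstLayerAnchor.lean`
 ((A⋆⋆), T-X4E-t1), split for `lint.size`; decl blocks byte-identical to the frozen sketch; duplicates by import; 0 Literature facts.)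

STATUS for R-X4E-t1 (supersession record, cc-lead ⟦gen60⟧ (2′)(iv)(E); the landed siblings are NOT re-worded): (A⋆⋆)
`FineMuZeroOfFirstLayerAnchor` (file `X4CongruenceFirstLayerAnchor.lean`) stands as a THEOREM-CANDIDATE (lit-kato AUD-19 PASS) but has
NO instance for {`388800ha1`, `388800ij1`} by the parity lemma (P-par) below (o6-r1 GEN 22 ADDENDUM 3, TARGETS G22-7 / G22-8); those two
targets are addressed by T-X4E-rig (this file + instances sibling); `388800ho1` / `388800ii1` stay on T-X4E ((A⋆) + (T-μ) + (Kμ-K)).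

HONEST FRAMING (cell `b2b-bsdres`, run/shared/lean/b2b/bsd-rank1-residual/, verbatim in every file): the goal of the cell is
to DELETE the COMBINATION-SHAPED residual classes of the Birch–Swinnerton-Dyer formula for ALL analytic-rank `≤ 1` elliptic
curves over `ℚ` — "full BSD formula for every rank `≤ 1` curve in class `C`" assembled STRICTLY from published theorems — so that
the rank-`≤ 1` remainder becomes exactly the CONSTRUCTION-SHAPED classes, which are TYPED (missing-input `Prop`s), NOT attempted.
This is not "finishing BSD". Lane CLASS-CLOSURE: research routes; census output is EVIDENCE / conjecture items, never a Literature
fact; no main conjecture inside any certificate; nothing is booked; no mark of `RESIDUAL-MAP.md` moves; O6 and X4 stay OPEN.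

WHAT IS TYPED (bodies verbatim from the frozen sketch; section texts = the planner's, verbatim): §X4E-t1-loc `flexLineValue`,
`FirstLayerLocalObstructionAtThree` ((G2-nec), bookkeeping), `@[conjecture] NoFirstLayerCertificateOfLocalObstruction` (kept live by
the frozen bytes, hence typed — cc-lead (F); SUPERSEDED as a route by ADDENDUM 2bis / 3: a census SORTER only); §X4E-t1-par
`curve388800ha1`, `curve388800ij1`, `FlexImageTrivialAtThree`, `@[conjecture] StrongPoolRootNumber` ((P-par), THEOREM-CANDIDATE; kept a
Prop target by o6-r1 — cc-lead (C)), PROVED `cube_ratio_mem_pow_three_mul_cube`; §X4E-rig vocabulary `LocallyIndivisibleByThree`,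
`LocallyIndivisibleByThreeAt` (ADDENDUM 7), `GeneratesModTorsionUpToThree`, `FlexImagesDisjointAtThree`, `FlexImageFullAtThree`, the
certificate target **`@[conjecture] SelmerRigidityCertificate` (T-X4E-rig)** and the candidate members `curve43200iv1`, `curve25920bf1`.
AUDIT WORDS OF RECORD: **lit-kato AUD-20 (i)–(v) PASS ×5 (GEN 38, `gen38/AUD-20-gen38.md` 66fcbf56fe5ee12d → 761454cf8cd73eda); typed
certificate FAITHFUL; (vi) T-X4E-rig-q PRE-READ pass-shaped**; N-7 (the A4.3 (ii) parenthesis) is ABSENT from the frozen bytes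
(handled by o6-r1); N-8 ('Prop. 4.10, Rem. 4.14' on the Poonen–Rains cite) applied by o6-r1.  'A PROOF of `SelmerRigidityCertificate`
is a typing / proving task over classical inputs (finite-S Poitou–Tate, local duality, the ℓ ≠ p Kummer / Tamagawa lemma, Silverman
X §1), not a Literature fact' (lit-kato) — NO fact is registered by this lane; `@[conjecture]` = EVIDENCE-labelled THEOREM-CANDIDATE
until a tree proof.  DEDUP (`lean search`, 2026-08-22): none of the new names exists; reused by name (import): `ModPCongruent`,
`IsFirstCyclotomicLayer`, `torsionPoints`, `HasIrreducibleModPGaloisRep`, `localTamagawaNumber`, `mordellWeilRank`, `sha`, `galH1`,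
`rootNumber`, `torsionOrder`, `tamagawaProduct`, `entireLFunction`, `realPeriodRat`.
EVIDENCE of record (instrumentation only; o6-r1 GEN 22 ADDENDA 2–4, kit j159647 / j159663 / j158951 (t1-loc), j160033 / j160083 /
j160120 / j160344 / j160459 (P-par), j160635 / j160459 / j160739 (Lagrangian census); census-lead GEN 25 l.11753 / l.11817: C-rig-2
SERVED, C-rig0 j161347 RE-TALLIED = memo, C-rig-1 / C-rig-3 predictions REGISTERED — PENDING (independent `--tool pari` run staged by
cc-eng-5 GEN 39 `class-closure/eng-5/crig-g39/`, rider (G))): see the section texts.  PRESEARCH (typer, 2026-08-22; corpus hybrid +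
vsearch, galaxy `--star all` ×3 needle sets = 0 rows): "Selmer group congruent elliptic curves local conditions Lagrangian quadratic
space rigidity" → [corpus: Silverman ATAEC / AEC X §1, Delbourgo 2008, Dokchitser–Dokchitser 2010 'BSD quotients modulo squares']
= the cited ingredients only; nearest in print Poonen–Rains 2012 §4 (Sel = global image ∩ ∏ κ_v, quadratic space), Mazur–Rubin 2010
Lemma 3.2 / Prop. 3.3 (structures differing at one place), Gross 1991 (Kolyvagin); no printed T-X4E-rig —
`presearch: SelmerRigidityCertificate → none beyond the cited antecedents (corpus + galaxy)`.
References: B. Poonen, E. Rains, J. Amer. Math. Soc. 25 (2012) Prop. 2.6, Prop. 4.10, Thm. 4.13, Rem. 4.14 [PoonenRains2012]; B. Mazur,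
K. Rubin, Ann. of Math. 171 (2010) Lemma 3.2, Prop. 3.3 [MazurRubin2010]; T. Dokchitser, V. Dokchitser, Ann. of Math. 172 (2010) Thm. 1.4
[DokchitserDokchitserAnnals2010]; J. S. Milne, ADT I Thm. 2.8, Cor. 2.3 / Thm. 2.13, Cor. I.3.4, Thm. I.4.10 [MilneADT2006]; B. H. Gross, in
L-functions and Arithmetic (1991) Thm. 1.3 / Prop. 2.1 [Gross1991]; G. Grigorov, A. Jorza, S. Patrikis, W. Stein, C. Tarniţă, Math. Comp. 78
(2009) §3 [GrigorovJorzaPatrikisSteinTarnita2009]; J. H. Silverman, AEC VIII §1, X §1, C §14 [SilvermanAEC2009]; T. Fisher, Math. Z. 271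
(2012) Thm. 1.1 [Fisher2012Hessian]; J. W. S. Cassels, J. reine angew. Math. 211 (1962) [Cassels1962ArithmeticIV]; R. L. Miller, LMS J.
Comput. Math. 14 (2011) §1, Def. 1.1 [Miller2011LMS].
-/

set_option autoImplicit false

noncomputable section

open scoped Classical

open WeierstrassCurve Literature.NumberTheory.EllipticCurves
  Literature.NumberTheory.EllipticCurves.Rank1Residual
  Literature.NumberTheory.EllipticCurves.Rank1Residual.Typed
  Summit.BirchSwinnertonDyer.Rank1Residual.Additive

namespace Summit.BirchSwinnertonDyer.Rank1Residual.O6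

/-! ## §X4E-t1-loc — the first-layer certificate is a LOCAL condition at `p`; the computable obstruction (G2-nec)

Genus theory for the cyclic cubic layer `K/ℚ` (memo §6.3′): for a unit anchor `W′` (Sel_{p^∞}(W′/ℚ) = 0, hence
`W′(K)[p] = 0`), inflation–restriction + Poitou–Tate + Mazur's lemma at the unramified primes (p ∤ c_ℓ) + Herbrand
quotient 1 at the unique ramified prime `𝔭 | p` give `#Sel_{p^∞}(W′/K)^{Gal(K/ℚ)} = p-part of [W′(ℚ_p) : N W′(K_𝔭)]`,
so the certificate `rank W′(K) = 0 ∧ Ш(W′/K)[p] = 0` ⟺ `Sel_{p^∞}(W′/K) = 0` ⟺ `p ∤ [W′(ℚ_p) : N_{K_𝔭/ℚ_p} W′(K_𝔭)]`.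
When `W′(ℚ_p)` has a point `P` of order `p = 3` (the `t′ = 1` case) one explicit class in
`H¹(Gal(K_𝔭/ℚ₃), W′(K_𝔭)) ⊂ H¹(ℚ₃, W′)[3]` is `σ ↦ χ_K(σ)·P`; by 3-isogeny descent (`φ : W′ → W′/⟨P⟩`, `ker φ̂ ≅ μ₃`,
`μ₃(ℚ₃) = 1`) and local duality (im κ_φ = (im κ_φ̂)^⊥, `N(K_𝔭^×)·ℚ₃^{×3} = 3^ℤ·ℚ₃^{×3}` for `K_𝔭 = ℚ₃(ζ₉)⁺`) it is
NONZERO iff the `φ̂`-descent map `Q ↦ f_P(Q) mod cubes` (`f_P` = the flex tangent line at `P`, `div f_P = 3(P) − 3(O)`)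
takes two values whose quotient lies outside `3^ℤ·(ℚ₃^×)³` — a finite `3`-adic computation on `W′/ℚ₃` alone
(script `gen22/x4e/t1loc_ytest.gp`; kit j159647: it reproduces the BSD-over-`K` verdicts 18/18, and all three `t′ = 1`
candidates of `388800ij1` carry the obstruction). -/
section X4Et1loc

/-- The value at `(x, y)` of the tangent line to the affine curve `W/ℚ₃` at a (flex) point `(x₀, y₀)`:
`f(x, y) = y − y₀ − λ (x − x₀)`, `λ = (3x₀² + 2a₂x₀ + a₄ − a₁y₀)/(2y₀ + a₁x₀ + a₃)`.  Bookkeeping. [folklore] -/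
noncomputable def flexLineValue (W : WeierstrassCurve ℚ_[3]) (x₀ y₀ x y : ℚ_[3]) : ℚ_[3] :=
  y - y₀ - (3 * x₀ ^ 2 + 2 * W.a₂ * x₀ + W.a₄ - W.a₁ * y₀) / (2 * y₀ + W.a₁ * x₀ + W.a₃) * (x - x₀)

/-- **(G2-nec) the FIRST-LAYER LOCAL OBSTRUCTION at `p = 3`** for `W′/ℚ`: there is a `ℚ₃`-rational point
`P = (x₀, y₀)` of order `3` and two affine `ℚ₃`-points `Q₁, Q₂` such that `f_P(Q₁)/f_P(Q₂) ∉ 3^ℤ · (ℚ₃^×)³`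
(both values nonzero).  Equivalently (derivation above): the image of the `φ̂`-descent map is not contained in
`N(ℚ₃(ζ₉)⁺^×) mod cubes`, so the class `χ_K ⊗ P` is not a local Kummer class.  Decidable to finite `3`-adic
precision; independent of the scaling of `f_P`.  Bookkeeping definition (nothing asserted). [folklore] -/
def FirstLayerLocalObstructionAtThree (W' : WeierstrassCurve ℚ) : Prop :=
  ∃ (x₀ y₀ : ℚ_[3]) (h₀ : (W'.baseChange ℚ_[3]).toAffine.Nonsingular x₀ y₀),
    WeierstrassCurve.Affine.Point.some x₀ y₀ h₀ ∈ torsionPoints W' ℚ_[3] 3 ∧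
    ∃ (x₁ y₁ x₂ y₂ : ℚ_[3]),
      (W'.baseChange ℚ_[3]).toAffine.Equation x₁ y₁ ∧ (W'.baseChange ℚ_[3]).toAffine.Equation x₂ y₂ ∧
      flexLineValue (W'.baseChange ℚ_[3]) x₀ y₀ x₁ y₁ ≠ 0 ∧ flexLineValue (W'.baseChange ℚ_[3]) x₀ y₀ x₂ y₂ ≠ 0 ∧
      ∀ (n : ℤ) (u : ℚ_[3]),
        flexLineValue (W'.baseChange ℚ_[3]) x₀ y₀ x₁ y₁ / flexLineValue (W'.baseChange ℚ_[3]) x₀ y₀ x₂ y₂ ≠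
          (3 : ℚ_[3]) ^ n * u ^ 3

/-- EVIDENCE: **theorem-candidate (memo §6.3′ (G1)–(G2) + ADDENDUM 2 (G2-nec); standard ingredients: genus theory for
cyclic extensions, 3-isogeny descent, Tate local duality; not reviewed — audit AUD-19)** — **(G2-nec ⇒ no first-layer
certificate).**  For a globally minimal `W′/ℚ` with `3 ∤ #W′(ℚ)_tors`, `L(W′,1)/Ω` a `3`-adic unit (so Sel₃∞(W′/ℚ) = 0
under BSD-type facts used elsewhere in this file) and `3 ∤ ∏ c_ℓ`, the local obstruction forces `Sel₃∞(W′/K) ≠ 0` for the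
first layer `K = ℚ(ζ₉)⁺`, i.e. the (A⋆⋆) hypothesis `rank W′(K) = 0 ∧ Ш(W′/K)[3] = 0` FAILS for every first layer `K`
(there is only one).  Census (kit j159647, j158951): the three `E[3]`-congruent unit candidates `25920s1/bf1/bf2` of
`388800ij1` satisfy `FirstLayerLocalObstructionAtThree`, consistent with `#Ш_an(W′/K) = 9, 9, 441`; on the
436-curve scan the obstruction reproduces the BSD-over-`K` verdict in 39/39 decided `t′ = 1` cases (kit j159663).
Its use: a conductor-unbounded SORTER for census ask C-X4E-1 (i′) (X_E(3)-family search, memo ADDENDUM 2/3): it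
refutes only the STRONG certificate `Sel_{3^∞}(W′/K) = 0`; the exact-strength (fine-Selmer) certificate (A⋆⋆♭)
of memo ADDENDUM 2bis survives it in (naively) two cases out of three ((G4): census C-X4E-2).  Nothing asserted.
[cite: MilneADT2006, Cor. I.3.4 (Tate local duality), Thm. I.2.8 (local Euler characteristic)]
[cite: SilvermanAEC2009, X.§1 (descent via isogeny), Exercise 10.1] -/
@[conjecture] def NoFirstLayerCertificateOfLocalObstruction : Prop :=
  ∀ (W' : WeierstrassCurve ℚ) [W'.IsElliptic] [W'.IsGloballyMinimal],
    ¬ 3 ∣ W'.torsionOrder →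
    (∃ q' : ℚ, W'.entireLFunction 1 / (W'.realPeriodRat : ℂ) = (q' : ℂ) ∧ q' ≠ 0 ∧ padicValRat 3 q' = 0) →
    ¬ 3 ∣ W'.tamagawaProduct →
    FirstLayerLocalObstructionAtThree W' →
    ∀ (K : Type) [Field K] [NumberField K], IsFirstCyclotomicLayer K 3 →
      (W'.baseChange K).mordellWeilRank = 0 →
      (W'.baseChange K).sha ⊓ AddSubgroup.torsionBy (W'.baseChange K).galH1 3 ≠ ⊥

end X4Et1loc

/-! ## X4E-t1-par — PARITY EXCLUSION of the strong first-layer certificate for the `t = 1` targets (o6-r1 GEN 22, ADDENDUM 3)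

The strong certificate (A⋆⋆) wants a rank-0 unit anchor `W′ ≡ W (mod 3)` with `Sel₃∞(W′/K) = 0`, `K = ℚ(ζ₉)⁺`; by
(G1)–(G2) this forces `χ_K ⊗ P ∈ κ₃(W′(ℚ₃)/3)` ((G2-nec) passes).  Inside the 4-dimensional quadratic `𝔽₃`-space
`H¹(ℚ₃, W[3])` (Poonen–Rains) the Lagrangians through the line `⟨χ_K ⊗ P⟩` are exactly two: `M₀ = H¹(ℚ₃, ⟨P⟩)`
(all `χ ⊗ P`) and `M′ = ⟨χ_K ⊗ P, w₁⟩` with `φ̂`-descent value `δ(w₁) = 3`; they lie in OPPOSITE rulings, and `M₀`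
lies in the ruling opposite to `κ₃(W)` for `W ∈ {388800ha1, 388800ij1}` (the `φ̂`-descent image of `W(ℚ₃)` is a
line, computed).  PARITY LEMMA (P-par): for a unit-compatible member `W′` (additive potentially good at `3`,
`3 ∤ ∏ c_ℓ(W′) · #W′(ℚ)_tors`) of either mod-3 congruence class, `w(W′) = w(W) · (−1)^{d₃}`,
`d₃ = dim κ₃(W)/(κ₃(W) ∩ κ₃(W′))`: the two Lagrangian Selmer structures on `H¹(ℚ, W[3])` agree at every `v ≠ 3`
(`H¹(ℚ_v, W[3]) = 0` for `v = 2, 5` since `W(ℚ_v)[3] ⊂ Φ_v[3] = 0`; at a multiplicative prime `ℓ ∉ {2,3,5}` of `W′`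
the module is unramified, so `3 ∣ v_ℓ(Δ′)`, so `W′` is non-split there (`3 ∤ c_ℓ`) and `κ_ℓ(W′) = H¹_ur = κ_ℓ(W)`;
no other additive primes by Raynaud), the Poitou–Tate comparison gives `dim Sel₃(W′) ≡ dim Sel₃(W) + d₃ (mod 2)`,
Cassels–Tate makes `dim Sel₃ ≡ corank Sel₃∞ (mod 2)` (`W′(ℚ)[3] = 0`), and the `3`-parity theorem over `ℚ` turns
coranks into root numbers (`w(W) = +1`, `r_an(W) = 0`).  Hence `κ₃(W′) = M₀` ⟹ `w(W′) = −1`: NO rank-0 unit anchor of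
these targets has trivial `φ̂`-descent image, and a rank-0 unit anchor passing (G2-nec) must have `κ₃(W′) = M′`
(descent image exactly `⟨3⟩`) — a configuration observed only together with `c₃(W′) = 3` (354/354 of 2416 sampled
members; 3-adic deep probe kit j160459).  NUMERICAL CONFIRMATION (kit j160033/j160083/j160120/j160344): every
unit-compatible member with trivial descent image whose root number was computed has `w = −1` (16/16 in the first
pass), every unit-compatible member with non-trivial image has `w = +1` (7/7).  CONSEQUENCE: for
R-X4E-t1 = {388800ha1, 388800ij1} only the FINE certificate (A⋆⋆♭) (ADDENDUM 2bis, census C-X4E-2) remains on the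
T-X4E-t1 line; the strong-pool search C-X4E-1 (i′) is cancelled for these two classes. -/

section X4Et1par

/-- Cremona `388800ha1` (O6 `t = 1` Elkies-corner target). Bookkeeping. [folklore] -/
def curve388800ha1 : WeierstrassCurve ℚ := ⟨0, 0, 0, -4860, -130410⟩

/-- Cremona `388800ij1` = the quadratic twist of `388800ha1` by `−5` (isomorphic to it over `ℚ₃`). Bookkeeping. [folklore] -/
def curve388800ij1 : WeierstrassCurve ℚ := ⟨0, 0, 0, -121500, 16301250⟩

/-- **TRIVIAL `φ̂`-DESCENT IMAGE at `3`**: `W′` has a `ℚ₃`-rational point `P = (x₀, y₀)` of order `3` and the flex-line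
values `f_P(Q)` at all affine `ℚ₃`-points `Q ∉ {O, P}` agree modulo cubes — i.e. the `φ̂`-descent map
`W′(ℚ₃) → ℚ₃^×/(ℚ₃^×)³` (`φ : W′ → W′/⟨P⟩`) is trivial, i.e. `κ₃(W′(ℚ₃)/3) = H¹(ℚ₃, ⟨P⟩) = M₀`.  It implies that
(G2-nec) passes (`¬ FirstLayerLocalObstructionAtThree W′`).  Decidable to finite `3`-adic precision
(`x4e/x4e_xe3_family.gp.in`, field `im = 1`).  Bookkeeping definition. [cite: SilvermanAEC2009, X.§1, Exercise 10.1] -/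
def FlexImageTrivialAtThree (W' : WeierstrassCurve ℚ) : Prop :=
  ∃ (x₀ y₀ : ℚ_[3]) (h₀ : (W'.baseChange ℚ_[3]).toAffine.Nonsingular x₀ y₀),
    WeierstrassCurve.Affine.Point.some x₀ y₀ h₀ ∈ torsionPoints W' ℚ_[3] 3 ∧
    ∀ (x₁ y₁ x₂ y₂ : ℚ_[3]),
      (W'.baseChange ℚ_[3]).toAffine.Equation x₁ y₁ → (W'.baseChange ℚ_[3]).toAffine.Equation x₂ y₂ →
      flexLineValue (W'.baseChange ℚ_[3]) x₀ y₀ x₁ y₁ ≠ 0 → flexLineValue (W'.baseChange ℚ_[3]) x₀ y₀ x₂ y₂ ≠ 0 →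
      ∃ u : ℚ_[3],
        flexLineValue (W'.baseChange ℚ_[3]) x₀ y₀ x₁ y₁ = u ^ 3 * flexLineValue (W'.baseChange ℚ_[3]) x₀ y₀ x₂ y₂

/-- EVIDENCE: **theorem-candidate (P-par), o6-r1 GEN 22 ADDENDUM 3 — ingredients all in print: the `p`-parity theorem
over `ℚ` (Dokchitser–Dokchitser), the Poitou–Tate comparison of two self-dual Selmer structures differing at one place
(as in Mazur–Rubin, Lemma 3.2/Prop. 3.3), the quadratic-space structure of `H¹(ℚ₃, W[3])` and `Sel₃ = ` (global image)
`∩ ∏ κ_v` (Poonen–Rains), the alternating Cassels–Tate pairing, plus two finite local computations for the targets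
(`W(ℚ₂)[3] = W(ℚ₅)[3] = 0`; the `φ̂`-descent image of `W(ℚ₃)` is a line); not reviewed — audit AUD-19.**
Every globally minimal `W′/ℚ` that is `E[3]`-congruent to `388800ha1` or `388800ij1`, additive potentially good at `3`,
with `3 ∤ ∏ c_ℓ(W′)` and `3 ∤ #W′(ℚ)_tors`, and whose `φ̂`-descent image at `3` is trivial, has global root number `−1`
(hence `L(W′, 1) = 0` and `W′` is never a rank-0 Kato anchor).  CENSUS FALSIFIER: one member of the explicit families
`X_W(3)`, `X_W⁻(3)` (Fisher) with `im = 1`, `3 ∤ tam · tors` and `ellrootno = +1` (pipeline `x4e/x4e_xe3_hunt.gp`;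
16/16 have `−1` so far).  Nothing asserted.
[cite: DokchitserDokchitserAnnals2010, Thm. 1.4 (= Thm. 4.19, p-parity over ℚ)]
[cite: MazurRubin2010, Lemma 3.2 and Prop. 3.3 (Poitou–Tate comparison)]
[cite: PoonenRains2012, Prop. 2.6 and Thm. 4.13] [cite: Cassels1962ArithmeticIV, alternating pairing on Ш]
[cite: Fisher2012Hessian, Thm. 1.1 (families X_E(3), X_E⁻(3); = arXiv:1403.7557 Thm. 2.6)] -/
@[conjecture] def StrongPoolRootNumber : Prop :=
  ∀ (W' : WeierstrassCurve ℚ) [W'.IsElliptic] [W'.IsGloballyMinimal],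
    (ModPCongruent curve388800ha1 W' 3 ∨ ModPCongruent curve388800ij1 W' 3) →
    ¬ W'.HasGoodReductionAtPrime 3 → ¬ W'.HasMultiplicativeReductionAtPrime 3 → 0 ≤ padicValRat 3 W'.j →
    ¬ 3 ∣ W'.tamagawaProduct → ¬ 3 ∣ W'.torsionOrder →
    FlexImageTrivialAtThree W' → W'.rootNumber = -1

/-- Sanity glue: a trivial `φ̂`-descent image excludes the first-layer local obstruction (G2-nec) FOR THE SAME flex
point — recorded in the weaker, purely propositional form actually needed by the census sorter: if all flex-line
ratios are cubes then no ratio avoids `3^ℤ · (ℚ₃^×)³`.  Bookkeeping. [folklore] -/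
theorem cube_ratio_mem_pow_three_mul_cube (a b u : ℚ_[3]) (hb : b ≠ 0) (h : a = u ^ 3 * b) :
    ∃ (n : ℤ) (v : ℚ_[3]), a / b = (3 : ℚ_[3]) ^ n * v ^ 3 :=
  ⟨0, u, by rw [h, zpow_zero, one_mul, mul_div_assoc, div_self hb, mul_one]⟩

end X4Et1par

/-! ## X4E-rig — the SELMER RIGIDITY CERTIFICATE (o6-r1 GEN 22, ADDENDUM 4): a Kato-free, Iwasawa-free closing
route for the `t = 1` targets `388800ha1`, `388800ij1`

RIGIDITY LEMMA (V-rig).  Fix `E/ℚ` with `ρ̄ = E[3]` irreducible and let `𝒯_E` be the set of curves `W/ℚ` with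
`W[3] ≃ E[3]` (as Galois modules) such that at every prime `ℓ ≠ 3` the local Kummer conditions of `W` and `E` coincide
in `H¹(ℚ_ℓ, E[3])` — which holds as soon as `3 ∤ c_ℓ(W)`, `3 ∤ c_ℓ(E)` for all `ℓ ≠ 3` and `E(ℚ_ℓ)[3] = 0` at the
additive primes `ℓ ≠ 3` of either curve (then `H¹(ℚ_ℓ, E[3]) = 0` by the local Euler characteristic; at a
multiplicative `ℓ` with `3 ∤ c_ℓ` the Kummer image is `H¹_ur` by the Tate parametrisation).  Put
`G = {ξ ∈ H¹(ℚ_Σ/ℚ, E[3]) : ξ unramified at the multiplicative primes in Σ}` (`Σ = {3, ∞} ∪` the bad primes of `E`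
and of the members used; the conditions at the additive primes `≠ 3` and at `∞` are vacuous),
`V = res₃(G) ⊂ H¹(ℚ₃, E[3])` and `S_str = ker res₃|_G`.  Then for every `W ∈ 𝒯_E`:
`Sel₃(W/ℚ) = {ξ ∈ G : res₃ ξ ∈ κ₃(W)}`, so `dim Sel₃(W) = dim S_str + dim (V ∩ κ₃(W))`, and `V` is isotropic for the
local Tate pairing (reciprocity for `Br(ℚ)[3]`), hence `dim V ≤ 2` — while every `κ₃(W)` is a Lagrangian plane of the
4-dimensional quadratic space `H¹(ℚ₃, E[3])` (here `E(ℚ₃)[3] = ⟨P⟩ ≅ ℤ/3`).  `S_str` and `V` depend on `ρ̄` only.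
CERTIFICATE (T-X4E-rig).  If some `W₃ ∈ 𝒯_E` has `Sel₃(W₃) = ⟨κ(g)⟩` with `g ∉ 3·W₃(ℚ₃)` (rank 1, `Ш(W₃)[3] = 0`:
KOLYVAGIN–GROSS on a congruent curve of ODD rank — the parity obstruction (P-par) turned into a resource) or
`Sel₃(W₃) = 0`, then `S_str = 0`; if moreover some `W₂ ∈ 𝒯_E` has `rank W₂(ℚ) ≥ 2` (two explicit points), then
`V = κ₃(W₂)`; and if the `φ̂`-descent images of `W₂(ℚ₃)` and `E(ℚ₃)` in `ℚ₃^×/(ℚ₃^×)³` are two DISTINCT LINES, then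
`κ₃(W₂) ∩ κ₃(E) = 0` (the `M₀`-parts are the distinct annihilator characters), whence
`Sel₃(E/ℚ) ≅ V ∩ κ₃(E) = 0`: `rank E(ℚ) = 0` and `Ш(E/ℚ)[3^∞] = 0` — the missing upper bound at `3`, with no
`3`-adic `L`-function, no Kato bound and no descent on `E` itself.
LAGRANGIAN CENSUS (kit j160635, j160459 — 3-adic depth `3⁶`, 1944 members): the eight Lagrangians are realised as
ruling A = {`Λ_a` = `κ₃(E)` (IV*, `c₃ = 3`, image `⟨3u⟩`), `Λ_b` (IV*, `c₃ = 3`, `⟨3u²⟩`), `Λ_K = M′` (IV*, `c₃ = 3`,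
`⟨3⟩`), `Λ_ur` (II with `c₃ = 1` = the fine pool, and IV with `c₃ = 3`; image `⟨u⟩`)} and ruling B = {`M₀` (IV, `c₃ = 1`,
the strong pool), im = 9 types (`X_E⁻(3)`, IV, `c₃ = 3`)}.  PREDICTIONS being tested by kit j160739
(`x4e/x4e_rig_scan.gp`): for `388800ha1` `V = Λ_ur` (all 42 rank-0 fine-pool members have `9 ∣ #Ш_an`, 27 fine members
have `L(W,1) = 0`), so `W₂` = any rank-2 fine-pool member and `W₃ = 43200iv1` (rank 1, strong pool) give the
certificate; for `388800ij1` `V ∈ {Λ_K, Λ_b}` (unit fine members exist), `W₂` = a rank-2 member of type `Λ_K` or `Λ_b`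
(necessarily `c₃(W₂) = 3`), `W₃` = a rank-1 strong-pool member or `W₁ = 25920bf1` (rank 0, Kolyvagin).  Census asks
C-rig-1 (Heegner index of `W₃`/`W₁` prime to 3: Sage `heegner_index`, GJPST-style), C-rig-2 (two independent points on
`W₂`: `ellrank` + `ellsaturation`), C-rig-3 (the three 3-adic checks: scripts in `x4e/`).  Audit AUD-20. -/

section X4Erig

/-- The rational affine point `(x, y)` of `W` is NOT divisible by `3` in `W(ℚ₃)` (its Kummer class at `3` is non-zero).
Decidable to finite 3-adic precision via `x(3R) = φ₃(x_R)/ψ₃²(x_R)` (`x4e/x4e_rig_scan.gp`, `div3loc`).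
Bookkeeping definition. [cite: SilvermanAEC2009, VIII.§1 and Exercise 3.7] -/
def LocallyIndivisibleByThree (W : WeierstrassCurve ℚ) (x y : ℚ) : Prop :=
  ∀ (h : (W.baseChange ℚ_[3]).toAffine.Nonsingular (x : ℚ_[3]) (y : ℚ_[3])),
    ¬ ∃ R : (W.baseChange ℚ_[3]).toAffine.Point,
      (3 : ℕ) • R = WeierstrassCurve.Affine.Point.some (x : ℚ_[3]) (y : ℚ_[3]) h

/-- The rational point `(x, y)` of `W` is NOT divisible by `3` in `W(ℚ_q)` (`q` any prime): its Kummer class has non-zero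
localisation in `H¹(ℚ_q, W[3])` (for `q ≠ 3` of good reduction: `P̄ ∉ 3 W̄(𝔽_q)`).  Bookkeeping definition (o6-r1 GEN 22
ADDENDUM 7: the refined second-member condition of the two-place certificate). [folklore] -/
def LocallyIndivisibleByThreeAt (W : WeierstrassCurve ℚ) (q : ℕ) [Fact q.Prime] (x y : ℚ) : Prop :=
  ∀ (h : (W.baseChange ℚ_[q]).toAffine.Nonsingular (x : ℚ_[q]) (y : ℚ_[q])),
    ¬ ∃ R : (W.baseChange ℚ_[q]).toAffine.Point,
      (3 : ℕ) • R = WeierstrassCurve.Affine.Point.some (x : ℚ_[q]) (y : ℚ_[q]) h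

/-- The rational affine point `g = (x, y)` generates `W(ℚ)` modulo torsion up to an index prime to `3`: every rational
point is `n • g + T + 3 • R` with `T` of finite order.  Bookkeeping definition. [folklore] -/
def GeneratesModTorsionUpToThree (W : WeierstrassCurve ℚ) (x y : ℚ) : Prop :=
  ∀ (h : W.toAffine.Nonsingular x y) (Q : W.toAffine.Point),
    ∃ (n : ℤ) (T R : W.toAffine.Point),
      IsOfFinAddOrder T ∧ Q = n • WeierstrassCurve.Affine.Point.some x y h + T + (3 : ℕ) • R

/-- **DISJOINT `φ̂`-DESCENT IMAGES at `3`**: for `ℚ₃`-rational points `P_i` of order `3` on `W_i` (`i = 1, 2`), the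
subgroups of `ℚ₃^×/(ℚ₃^×)³` formed by the classes of flex-line ratios `f_{P_1}(Q₁)/f_{P_1}(R₁)` on `W₁(ℚ₃)` and
`f_{P_2}(Q₂)/f_{P_2}(R₂)` on `W₂(ℚ₃)` meet only in the trivial class.  With both images LINES (`¬ FlexImageTrivialAtThree`,
image ≠ everything) this forces `κ₃(W₁) ∩ κ₃(W₂) = 0` in `H¹(ℚ₃, W₁[3]) = H¹(ℚ₃, W₂[3])` (any identification
`W₁[3] ≃ W₂[3]` preserves the image lines and their annihilator characters).  Decidable to finite 3-adic precision
(`ktype` in `x4e/x4e_rig_scan.gp`: types `Lur = ⟨u⟩`, `LK = ⟨3⟩`, `La = ⟨3u⟩`, `Lb = ⟨3u²⟩`).  Bookkeeping definition.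
[cite: SilvermanAEC2009, X.§1, Exercise 10.1] [cite: PoonenRains2012, Prop. 2.6 and §4] -/
def FlexImagesDisjointAtThree (W₁ W₂ : WeierstrassCurve ℚ) : Prop :=
  ∀ (x₁ y₁ : ℚ_[3]) (h₁ : (W₁.baseChange ℚ_[3]).toAffine.Nonsingular x₁ y₁)
    (x₂ y₂ : ℚ_[3]) (h₂ : (W₂.baseChange ℚ_[3]).toAffine.Nonsingular x₂ y₂),
    WeierstrassCurve.Affine.Point.some x₁ y₁ h₁ ∈ torsionPoints W₁ ℚ_[3] 3 →
    WeierstrassCurve.Affine.Point.some x₂ y₂ h₂ ∈ torsionPoints W₂ ℚ_[3] 3 →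
    ∀ (a₁ b₁ c₁ d₁ a₂ b₂ c₂ d₂ : ℚ_[3]),
      (W₁.baseChange ℚ_[3]).toAffine.Equation a₁ b₁ → (W₁.baseChange ℚ_[3]).toAffine.Equation c₁ d₁ →
      (W₂.baseChange ℚ_[3]).toAffine.Equation a₂ b₂ → (W₂.baseChange ℚ_[3]).toAffine.Equation c₂ d₂ →
      flexLineValue (W₁.baseChange ℚ_[3]) x₁ y₁ a₁ b₁ ≠ 0 → flexLineValue (W₁.baseChange ℚ_[3]) x₁ y₁ c₁ d₁ ≠ 0 →
      flexLineValue (W₂.baseChange ℚ_[3]) x₂ y₂ a₂ b₂ ≠ 0 → flexLineValue (W₂.baseChange ℚ_[3]) x₂ y₂ c₂ d₂ ≠ 0 →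
      (∃ u : ℚ_[3], flexLineValue (W₁.baseChange ℚ_[3]) x₁ y₁ a₁ b₁ * flexLineValue (W₂.baseChange ℚ_[3]) x₂ y₂ c₂ d₂ =
          u ^ 3 * (flexLineValue (W₁.baseChange ℚ_[3]) x₁ y₁ c₁ d₁ * flexLineValue (W₂.baseChange ℚ_[3]) x₂ y₂ a₂ b₂)) →
      ∃ v : ℚ_[3], flexLineValue (W₁.baseChange ℚ_[3]) x₁ y₁ a₁ b₁ = v ^ 3 * flexLineValue (W₁.baseChange ℚ_[3]) x₁ y₁ c₁ d₁

/-- **FULL `φ̂`-DESCENT IMAGE at `3`** (im = 9, ruling B): some pair of flex-line ratios spans `ℚ₃^×/(ℚ₃^×)³`, i.e. there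
are ratios `r, s` with `r ∉ s^ℤ · (ℚ₃^×)³` and `s ∉ (ℚ₃^×)³` — recorded as: there exist two ratios such that no
product `r^i s^j` (`(i,j) ≠ (0,0) mod 3`) is a cube.  Bookkeeping definition. [folklore] -/
def FlexImageFullAtThree (W' : WeierstrassCurve ℚ) : Prop :=
  ∃ (x₀ y₀ : ℚ_[3]) (h₀ : (W'.baseChange ℚ_[3]).toAffine.Nonsingular x₀ y₀),
    WeierstrassCurve.Affine.Point.some x₀ y₀ h₀ ∈ torsionPoints W' ℚ_[3] 3 ∧
    ∃ (r s : ℚ_[3]), r ≠ 0 ∧ s ≠ 0 ∧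
      (∃ (a b c d : ℚ_[3]), (W'.baseChange ℚ_[3]).toAffine.Equation a b ∧ (W'.baseChange ℚ_[3]).toAffine.Equation c d ∧
        flexLineValue (W'.baseChange ℚ_[3]) x₀ y₀ c d ≠ 0 ∧
        r * flexLineValue (W'.baseChange ℚ_[3]) x₀ y₀ c d = flexLineValue (W'.baseChange ℚ_[3]) x₀ y₀ a b) ∧
      (∃ (a b c d : ℚ_[3]), (W'.baseChange ℚ_[3]).toAffine.Equation a b ∧ (W'.baseChange ℚ_[3]).toAffine.Equation c d ∧
        flexLineValue (W'.baseChange ℚ_[3]) x₀ y₀ c d ≠ 0 ∧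
        s * flexLineValue (W'.baseChange ℚ_[3]) x₀ y₀ c d = flexLineValue (W'.baseChange ℚ_[3]) x₀ y₀ a b) ∧
      ∀ (i j : ℕ), i < 3 → j < 3 → (i, j) ≠ (0, 0) → ¬ ∃ v : ℚ_[3], r ^ i * s ^ j = v ^ 3

/-- EVIDENCE: **theorem-candidate T-X4E-rig (SELMER RIGIDITY CERTIFICATE), o6-r1 GEN 22 ADDENDUM 4 — proof sketch in
the section docstring; every ingredient is classical (Kummer theory, local Tate duality and the local Euler
characteristic, reciprocity for `Br(ℚ)[3]`, the Tate curve, descent via 3-isogeny); not reviewed — audit AUD-20.**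
For `W, W₂, W₃ /ℚ` pairwise `E[3]`-congruent, `ρ̄_{W,3}` irreducible, `W(ℚ₃)[3] ≅ ℤ/3`, local conditions away from
`3` matched (`3 ∤ c_ℓ` for all three at every `ℓ ≠ 3`; no `ℚ_ℓ`-rational `3`-torsion at the additive primes
`ℓ ≠ 3`), with (i) `W₃` of rank `≤ 1`, `Ш(W₃)[3] = 0`, `3 ∤ #W₃(ℚ)_tors`, and in rank one a generator up to
index prime to `3` that is not `3`-divisible in `W₃(ℚ₃)`; (ii) `rank W₂(ℚ) ≥ 2`; (iii) the `φ̂`-descent images of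
`W(ℚ₃)` and `W₂(ℚ₃)` non-trivial, not full, and disjoint — one has `rank W(ℚ) = 0` and `Ш(W/ℚ)[3] = 0`.
INSTANCES SOUGHT (census C-rig-1/2/3): `W = 388800ha1`, `W₃ = 43200iv1`, `W₂` = a rank-2 member of `X_W⁻(3)` of
Kodaira type II at 3; `W = 388800ij1`, `W₃` = a rank-1 member of type IV (`c₃ = 1`) or the rank-0 variant
`W₁ = 25920bf1`, `W₂` = a rank-2 member of type IV* with image `⟨3⟩` or `⟨3u²⟩`.  CENSUS FALSIFIER of the
underlying rigidity predictions: a rank-0 member of `𝒯_{388800ha1}` of type II/`Λ_ur` with `3 ∤ #Ш_an`, or two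
rank-2 members of one class with different image lines, or an im = 9 / `M₀` member with root number `+1`
(kit j160739).  Nothing asserted.
[cite: PoonenRains2012, Prop. 2.6, Prop. 4.10, Thm. 4.13, Rem. 4.14 (quadratic space H¹(ℚ₃,E[3]); Sel = global image ∩ ∏ κ_v; finite-Σ Poitou–Tate)]
[cite: MazurRubin2010, Lemma 3.2 and Prop. 3.3 (comparison of Selmer structures differing at one place)]
[cite: MilneADT2006, I Thm. 2.8 (local duality), I Thm. 2.13/Cor. 2.3 (local Euler characteristic), I Thm. 4.10 (Poitou–Tate)]
[cite: Gross1991, Thm. 1.3 / Prop. 2.1 (Kolyvagin: ρ̄ surjective, p ∤ [E(K) : ℤ y_K] ⇒ Ш(E/K)[p] = 0)]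
[cite: GrigorovJorzaPatrikisSteinTarnita2009, §3 (Kolyvagin bound in BSD verification)] [cite: SilvermanAEC2009, X.§1; C.§14 (Tate curve)] -/
@[conjecture] def SelmerRigidityCertificate : Prop :=
  ∀ (W W₂ W₃ : WeierstrassCurve ℚ) [W.IsElliptic] [W₂.IsElliptic] [W₃.IsElliptic]
    [W.IsGloballyMinimal] [W₂.IsGloballyMinimal] [W₃.IsGloballyMinimal],
    W.HasIrreducibleModPGaloisRep 3 →
    ModPCongruent W W₂ 3 → ModPCongruent W W₃ 3 →
    Nat.card (torsionPoints W ℚ_[3] 3) = 3 →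
    (∀ (ℓ : ℕ) [Fact ℓ.Prime], ℓ ≠ 3 →
      ¬ 3 ∣ (W.baseChange ℚ_[ℓ]).localTamagawaNumber ℤ_[ℓ] ∧
      ¬ 3 ∣ (W₂.baseChange ℚ_[ℓ]).localTamagawaNumber ℤ_[ℓ] ∧
      ¬ 3 ∣ (W₃.baseChange ℚ_[ℓ]).localTamagawaNumber ℤ_[ℓ]) →
    (∀ (ℓ : ℕ) [Fact ℓ.Prime], ℓ ≠ 3 →
      ((¬ W.HasGoodReductionAtPrime ℓ ∧ ¬ W.HasMultiplicativeReductionAtPrime ℓ) ∨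
        (¬ W₂.HasGoodReductionAtPrime ℓ ∧ ¬ W₂.HasMultiplicativeReductionAtPrime ℓ) ∨
        (¬ W₃.HasGoodReductionAtPrime ℓ ∧ ¬ W₃.HasMultiplicativeReductionAtPrime ℓ)) →
      torsionPoints W ℚ_[ℓ] 3 = ⊥) →
    -- (i) the Kolyvagin member W₃
    ¬ 3 ∣ W₃.torsionOrder → (∀ s : W₃.sha, (3 : ℕ) • s = 0 → s = 0) →
    (W₃.mordellWeilRank = 0 ∨
      (W₃.mordellWeilRank = 1 ∧ ∃ (x y : ℚ), W₃.toAffine.Nonsingular x y ∧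
        GeneratesModTorsionUpToThree W₃ x y ∧ LocallyIndivisibleByThree W₃ x y)) →
    -- (ii) the rank-two member W₂
    2 ≤ W₂.mordellWeilRank →
    -- (iii) the 3-adic position of the two Kummer Lagrangians
    ¬ FlexImageTrivialAtThree W → ¬ FlexImageTrivialAtThree W₂ →
    ¬ FlexImageFullAtThree W → ¬ FlexImageFullAtThree W₂ →
    FlexImagesDisjointAtThree W W₂ →
    W.mordellWeilRank = 0 ∧ ∀ s : W.sha, (3 : ℕ) • s = 0 → s = 0

/-- Cremona `43200iv1` — the rank-one member of `X_{388800ha1}(3)` at `(λ : μ) = (−15 : 1)` (Kodaira IV at 3,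
`c₃ = 1`, trivial `φ̂`-descent image, root number `−1`; `∏ c_ℓ = 2`, trivial torsion, surjective `ρ̄_{3}`): the
proposed Kolyvagin member `W₃` for `388800ha1`.  Bookkeeping. [folklore] -/
def curve43200iv1 : WeierstrassCurve ℚ := ⟨0, 0, 0, -300, -4250⟩

/-- Cremona `25920bf1` — a rank-zero member of the mod-3 class of `388800ij1` (type II at 3, `c₃ = 1`, `#Ш_an = 1`,
`∏ c_ℓ = 2`): the proposed rank-zero Kolyvagin member `W₁` for `388800ij1`.  Bookkeeping. [folklore] -/
def curve25920bf1 : WeierstrassCurve ℚ := ⟨0, 0, 0, -12, 496⟩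

end X4Erig

end Summit.BirchSwinnertonDyer.Rank1Residual.O6

end
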